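import Literature.RingTheory.CohomologyAnnihilator.KaehlerDifferent
import Summits.ResolutionOfSingularities.ResolutionOfSingularities.Theorems.HomologicalConductorPersistenceFrobeniusDifferent
import Summits.ResolutionOfSingularities.ResolutionOfSingularities.Theorems.HomologicalConductorNoZenoJacobianFloorBridge
import HarnessLib

/-!
# Crux `NoZenoR` (stmt-ResolutionOfSingularities-19943) — the KÄHLER-DIFFERENT FLOOR on the
# Cohen–Macaulay locus: `Fitt₀(Ω[B⁄A]) ⊆ caᵈ⁺¹(B)` for `B` finite projective over `A`

Route `ResolutionOfSingularities/HomologicalConductor`, chain W4.4 (cell res-hironaka, seat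
res-L0-w44-stub-1 gen 10). OURS: AI-written support lemmas, weaker than expert review; nothing here
is a statement of the manuscript under review (Hironaka 2017), and nothing here is a NAMED FACT.

Context. The W4.4 slot-7 thread floor (J′) consumes the named fact F-89a′
`Literature.RingTheory.CohomologyAnnihilator.jacobianFloorNN_normal_dim3` (Iyengar–Takahashi 2016,
Thm 3.8 on one Kähler-different summand of `jac`: for a noetherian normal domain `B` of dimension `3`
and a Noether normalisation `A → B`, `Fitt₀(Ω[B⁄A]) ≤ ca⁴(B)`), whose proof in print needs the DERIVED
Noether different (loc. cit. §2) because a normal threefold need not be Cohen–Macaulay. On the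
Cohen–Macaulay locus — `B` module-finite and PROJECTIVE over `A` — the floor is ELEMENTARY and is
proved here unconditionally, by composing two tree results:

* `Literature.RingTheory.CohomologyAnnihilator.fittingIdeal_kaehlerDifferential_le_noetherDifferent`
  — the Kähler different lies in the Noether different, `Fitt₀(Ω[B⁄A]) ≤ 𝔑(B/A)` (Scheja–Storch
  Satz 15.4 = Iyengar–Takahashi 2016 display (3.1));
* `PersistenceFrobeniusDifferent.noetherDifferent_le_cohomologyAnnihilatorOfDegree_of_projective`
  (chain w44b, res-L1-w44b-idea-2) — `𝔑(B/A) ≤ caᵈ⁺¹(B)` for `B` finite projective over noetherian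
  `A` with `caᵈ⁺¹(A) = A` (Iyengar–Takahashi 2014 Prop. 3.4 with `I' = A`).

## Content (all proved, def-free)

* `fittingIdeal_kaehlerDifferential_le_cohomologyAnnihilatorOfDegree_of_projective` —
  `caᵈ⁺¹(A) = A`, `B` finite projective over `A` ⇒ `Fitt₀(Ω[B⁄A]) ≤ caᵈ⁺¹(B)`.
* `…_of_isRegularRing` — the same for `A` regular noetherian of Krull dimension `≤ d`.
* `fittingIdeal_kaehlerDifferential_mvPolynomial_le_cohomologyAnnihilatorOfDegree` — the same for a
  polynomial Noether normalisation `k[X₁, …, X_d] → B` (`B` finite and projective over it, e.g. a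
  Cohen–Macaulay graded ring over a homogeneous system of parameters; every normal SURFACE over its
  Noether normalisation).
* `iSup_fittingIdeal_kaehlerDifferential_le_cohomologyAnnihilatorOfDegree` — the Cohen–Macaulay
  JACOBIAN floor `Σ_A Fitt₀(Ω[B⁄A]) ⊆ caᵈ⁺¹(B)` over any family of such structures (the paper's
  `jac(B)` restricted to projective Noether normalisations).
* `jacobianFloorNN_normal_dim3_of_projective` — F-89a′'s conclusion `Fitt₀(Ω[B⁄A]) ≤ ca⁴(B)` for
  `B` finite projective over `A` with `ca⁴(A) = A`, WITHOUT normality / dimension / domain hypotheses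
  (the part of F-89a′ that is now a theorem; the non-Cohen–Macaulay normal case remains the fact).
* `mem_ca_tower_of_mem_kaehlerDifferent_of_projective` — the (J′-thread) floor ALONG THE TOWER,
  UNCONDITIONAL on the Cohen–Macaulay locus: for a finitely generated model `B ≤ T_m` with
  unit-denominator fractions and a Noether normalisation `S → ↥B` over which `↥B` is PROJECTIVE with
  `caᵈ⁺¹(S) = S`, every `x ∈ Fitt₀(Ω[↥B⁄S])` lies in the route's `ca (T_m)` (res-L0-w44-stub-3's
  fact-free core `JacobianFloor.mem_ca_tower_of_mem_cohomologyAnnihilatorOfDegree`, p550078, fed by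
  the projective floor instead of the fact).

References (mechanism only): S. B. Iyengar, R. Takahashi, arXiv:1610.02599 §3 (3.1), Thm 3.8
[`IyengarTakahashi2016`]; arXiv:1404.1476 Prop. 3.4 [`IyengarTakahashi2014`].
-/

noncomputable section

-- single-problem summit: the doubled namespace component `ResolutionOfSingularities` is forced
set_option linter.dupNamespace false

open Literature.RingTheory.CohomologyAnnihilator Literature.RingTheory.FittingIdeal
open Summit.ResolutionOfSingularities.ResolutionOfSingularities.Theorems.HomologicalConductor

universe u

namespace Summit.ResolutionOfSingularities.ResolutionOfSingularities.Theorems.NoZeno.KaehlerDifferentFloor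

variable {A : Type u} [CommRing A] {B : Type u} [CommRing B] [Algebra A B]

/-- **Kähler-different floor, projective case (OURS).** For `B` module-finite and projective over the
noetherian ring `A` with `caᵈ⁺¹(A) = A`: `Fitt₀(Ω[B⁄A]) ≤ caᵈ⁺¹(B)` — the Kähler different lies in
the Noether different (Scheja–Storch), which lies in `caᵈ⁺¹(B)` (Iyengar–Takahashi 2014 Prop. 3.4,
projective case, tree `PersistenceFrobeniusDifferent`). [this work; composition of tree results] -/
theorem fittingIdeal_kaehlerDifferential_le_cohomologyAnnihilatorOfDegree_of_projective
    [IsNoetherianRing A] [Module.Finite A B] [Module.Projective A B] {d : ℕ}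
    (hvan : cohomologyAnnihilatorOfDegree A (d + 1) = ⊤) :
    Module.fittingIdeal B (Ω[B⁄A]) 0 ≤ cohomologyAnnihilatorOfDegree B (d + 1) :=
  fittingIdeal_kaehlerDifferential_le_noetherDifferent.trans
    (PersistenceFrobeniusDifferent.noetherDifferent_le_cohomologyAnnihilatorOfDegree_of_projective
      hvan)

/-- The same over a REGULAR noetherian base of Krull dimension `≤ d`. [this work; composition] -/
theorem fittingIdeal_kaehlerDifferential_le_cohomologyAnnihilatorOfDegree_of_isRegularRing
    [IsRegularRing A] [Module.Finite A B] [Module.Projective A B] {d : ℕ}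
    (hdim : ringKrullDim A ≤ d) :
    Module.fittingIdeal B (Ω[B⁄A]) 0 ≤ cohomologyAnnihilatorOfDegree B (d + 1) :=
  fittingIdeal_kaehlerDifferential_le_noetherDifferent.trans
    (PersistenceFrobeniusDifferent.noetherDifferent_le_cohomologyAnnihilatorOfDegree_of_isRegularRing
      hdim)

/-- The same for a polynomial Noether normalisation `k[X₁, …, X_d] → B` with `B` module-finite and
projective over it (e.g. a Cohen–Macaulay graded ring, free over a homogeneous system of
parameters): `Fitt₀(Ω[B⁄k[X]]) ≤ caᵈ⁺¹(B)`. [this work; composition] -/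
theorem fittingIdeal_kaehlerDifferential_mvPolynomial_le_cohomologyAnnihilatorOfDegree
    (k : Type u) [Field k] (d : ℕ) {B : Type u} [CommRing B] [Algebra (MvPolynomial (Fin d) k) B]
    [Module.Finite (MvPolynomial (Fin d) k) B] [Module.Projective (MvPolynomial (Fin d) k) B] :
    Module.fittingIdeal B (Ω[B⁄MvPolynomial (Fin d) k]) 0 ≤ cohomologyAnnihilatorOfDegree B (d + 1) :=
  fittingIdeal_kaehlerDifferential_le_noetherDifferent.trans
    (PersistenceFrobeniusDifferent.noetherDifferent_mvPolynomial_le_cohomologyAnnihilatorOfDegree k d)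

/-- **The Cohen–Macaulay Jacobian floor (OURS).** For any family of algebra structures `Aᵢ → B`
(e.g. all projective Noether normalisations of `B`) with `B` module-finite projective over each
`Aᵢ` and `caᵈ⁺¹(Aᵢ) = Aᵢ`: `⨆ᵢ Fitt₀(Ω[B⁄Aᵢ]) ≤ caᵈ⁺¹(B)` — the paper's `jac(B) = Σ_A 𝔡_K(B/A)`
(Iyengar–Takahashi 2016 §3) restricted to projective normalisations. [this work; composition] -/
theorem iSup_fittingIdeal_kaehlerDifferential_le_cohomologyAnnihilatorOfDegree {κ : Type*}
    (R : κ → Type u) [∀ i, CommRing (R i)] [∀ i, Algebra (R i) B] [∀ i, IsNoetherianRing (R i)]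
    [∀ i, Module.Finite (R i) B] [∀ i, Module.Projective (R i) B] {d : ℕ}
    (hvan : ∀ i, cohomologyAnnihilatorOfDegree (R i) (d + 1) = ⊤) :
    ⨆ i, Module.fittingIdeal B (Ω[B⁄R i]) 0 ≤ cohomologyAnnihilatorOfDegree B (d + 1) :=
  iSup_le fun i =>
    fittingIdeal_kaehlerDifferential_le_cohomologyAnnihilatorOfDegree_of_projective (hvan i)

/-- **F-89a′ on the Cohen–Macaulay locus is a theorem (OURS).** The conclusion of the named fact
`Literature.RingTheory.CohomologyAnnihilator.jacobianFloorNN_normal_dim3` — `Fitt₀(Ω[B⁄A]) ≤ ca⁴(B)`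
— holds for EVERY `B` module-finite and projective over a noetherian `A` with `ca⁴(A) = A` (no
normality, dimension or domain hypothesis on `B`); e.g. `A = k[y₁, y₂, y₃]`
(`cohomologyAnnihilatorOfDegree_mvPolynomial_eq_top`). The normal non-Cohen–Macaulay case of the
fact (Iyengar–Takahashi 2016 Thm 3.8, derived Noether different) is NOT proved here.
[this work; composition] -/
theorem jacobianFloorNN_normal_dim3_of_projective (B : Type u) [CommRing B]
    (A : Type u) [CommRing A] [IsNoetherianRing A] [Algebra A B] [Module.Finite A B]
    [Module.Projective A B] (hvan : cohomologyAnnihilatorOfDegree A 4 = ⊤) :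
    Module.fittingIdeal B (Ω[B⁄A]) 0 ≤ cohomologyAnnihilatorOfDegree B 4 :=
  fittingIdeal_kaehlerDifferential_le_cohomologyAnnihilatorOfDegree_of_projective (d := 3) hvan

/-- **(J′-thread) along the tower, UNCONDITIONAL on the Cohen–Macaulay locus (OURS).** For a stage
`T_m` of the canonical tower, a finitely generated model `B ≤ T_m` over which `T_m` consists of
fractions with `T_m`-unit denominators, and a Noether normalisation `S → ↥B` (noetherian,
`caᵈ⁺¹(S) = S`) over which `↥B` is module-finite and PROJECTIVE: every `x ∈ Fitt₀(Ω[↥B⁄S])` lies in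
the route's `ca (T_m)` — res-L0-w44-stub-3's fact-free transport
`JacobianFloor.mem_ca_tower_of_mem_cohomologyAnnihilatorOfDegree` fed by the projective floor instead
of the named fact F-89a′ (compare `JacobianFloor.mem_ca_tower_of_mem_kaehlerDifferent`, which is
conditional on the fact but needs no projectivity). [this work; composition of tree results] -/
theorem mem_ca_tower_of_mem_kaehlerDifferent_of_projective (k K : Type) [Field k] [Field K]
    [Algebra k K] (O : ValuationSubring K) (A : Subalgebra k K) (m : ℕ) (B : Subalgebra k K)
    (hBfg : B.FG) (hBT : B ≤ NoZeno.Birth.tower O A m)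
    (hfrac : ∀ s ∈ NoZeno.Birth.tower O A m,
      ∃ a ∈ B, ∃ t ∈ B, t ≠ 0 ∧ t⁻¹ ∈ NoZeno.Birth.tower O A m ∧ s = a * t⁻¹)
    (S : Type) [CommRing S] [IsNoetherianRing S] [Algebra S ↥B] [Module.Finite S ↥B]
    [Module.Projective S ↥B] {d : ℕ} (hvan : cohomologyAnnihilatorOfDegree S (d + 1) = ⊤)
    (x : ↥B) (hx : x ∈ Module.fittingIdeal ↥B (Ω[↥B⁄S]) 0) :
    (x : K) ∈ NoZeno.Birth.ca (NoZeno.Birth.tower O A m) :=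
  NoZeno.JacobianFloor.mem_ca_tower_of_mem_cohomologyAnnihilatorOfDegree O A m B hBfg hBT hfrac
    (d + 1) x (fittingIdeal_kaehlerDifferential_le_cohomologyAnnihilatorOfDegree_of_projective hvan hx)

end Summit.ResolutionOfSingularities.ResolutionOfSingularities.Theorems.NoZeno.KaehlerDifferentFloor

end
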